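import Summits.SmoothPoincare4.SmoothPoincare4.Theorems.WeakReductionDescentDependentTripleGenusThreeStandardStubBoundsDiscOfAnnularChartAux2
import Literature.Topology.FourManifolds.WeaklyReducibleTrisections
import Literature.Geometry.Manifold.SmoothEmbeddingInverse
import HarnessLib

/-!
# Non-separation of curves transports across an annular chart of the central surface

Helper file (`--supports stmt-SmoothPoincare4-18000`, registered helper
`helper_hasDependentTriple_of_isWeaklyReducible` of the skeleton
`Cruxes/DependentTripleGenusThreeStandard/Lines/Sketch.lean`, Aux2).

Let `T` be a Gay–Kirby trisection of a smooth `4`-manifold `M`, `F = centralSurfaceSet T`, and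
`ψ : ℝ² → M` an annular chart of `F` (smooth, injective and immersive INTO `M` on the open round
annulus `A = {r_lo < ‖x‖ < r_hi}`, with `ψ(A) ⊆ F`).  If the round circle `ψ(r₀ 𝕊¹)` is
NON-SEPARATING (`F ∖ ψ(r₀ 𝕊¹)` connected) then so is every other round circle `ψ(r₁ 𝕊¹)`
(`helper_isNonSeparating_roundCircle_of_annularChart`, REGISTERED helper).  Road, all inputs
proved in the tree:

* clause (iii) of `IsGKTrisection` for the pair `(0, 1)`: a smooth embedding `h : H → M` of a
  compact `3`-manifold with boundary with `h(∂H) = F`;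
* `helper_exists_diffeomorph_sweep_of_annularChart` (`…StubBoundsDiscOfAnnularChartAux2.lean`):
  a diffeomorphism `Φ` of `H` with `Φ(∂H) = ∂H` and `Φ (h⁻¹ (ψ (r₀ x))) = h⁻¹ (ψ (r₁ x))`;
* the map `θ = h ∘ Φ ∘ h⁻¹` is continuous on `range h ⊇ F`
  (`Literature.Geometry.Manifold.contMDiffOn_invFun_range`) and maps `F ∖ ψ(r₀ 𝕊¹)` onto
  `F ∖ ψ(r₁ 𝕊¹)` (injectivity of `h`, `Φ`), so connectedness passes to the image
  (`IsConnected.image`).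

No definitions, no named facts.

References: R. Aranda, A. Zupan, arXiv:2503.04607 (2025), p. 2 and Remark 2.5 (p. 6);
M. W. Hirsch, *Differential Topology* (1976), Ch. 8 §1 Thm. 1.3, §2 Thm. 2.3.
-/

-- the registered namespace `Summit.SmoothPoincare4.SmoothPoincare4.Theorems…` repeats a component
set_option linter.dupNamespace false

noncomputable section

open scoped Manifold ContDiff Topology
open Set Function Metric
open Literature.Topology.FourManifolds
open Literature.Topology.FourManifolds.Trisection

namespace Summit.SmoothPoincare4.SmoothPoincare4.Theorems

/-- **Non-separation transports across an annular chart of the central surface** (REGISTERED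
helper of the crux `DependentTripleGenusThreeStandard`, line `Sketch`, exactness lemma): for an
annular chart `ψ` of `F = centralSurfaceSet T` (smooth, injective, immersive into `M` on
`{r_lo < ‖x‖ < r_hi}`, image in `F`) and radii `r_lo < r₀, r₁ < r_hi` (positive), if the round
circle `ψ(r₀ 𝕊¹)` is non-separating in `F` then so is `ψ(r₁ 𝕊¹)`: the sweep diffeomorphism of the
clause-(iii) handlebody read on `F` is a continuous bijection `F ∖ ψ(r₀ 𝕊¹) → F ∖ ψ(r₁ 𝕊¹)`.
[cite: ArandaZupan2025, p. 2 and Remark 2.5 (p. 6)]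
[cite: HirschDT1976, Ch. 8 §1 Thm. 1.3 and Ch. 8 §2 proof of Thm. 2.3] -/
theorem helper_isNonSeparating_roundCircle_of_annularChart :
    ∀ (M : Type) [TopologicalSpace M] [T2Space M] [SecondCountableTopology M]
      [ChartedSpace (EuclideanSpace ℝ (Fin 4)) M] [IsManifold (𝓡 4) ∞ M],
      ∀ (g : ℕ) (k : Fin 3 → ℕ) (T : Fin 3 → Set M), IsGKTrisection M g k T →
      ∀ (ψ : EuclideanSpace ℝ (Fin 2) → M) (rlo r₀ r₁ rhi : ℝ),
      0 < r₀ → 0 < r₁ → rlo < r₀ → rlo < r₁ → r₀ < rhi → r₁ < rhi →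
      ContMDiffOn (𝓡 2) (𝓡 4) ∞ ψ {x | rlo < ‖x‖ ∧ ‖x‖ < rhi} →
      Set.InjOn ψ {x | rlo < ‖x‖ ∧ ‖x‖ < rhi} →
      (∀ x : EuclideanSpace ℝ (Fin 2), rlo < ‖x‖ → ‖x‖ < rhi →
        Function.Injective (mfderiv (𝓡 2) (𝓡 4) ψ x)) →
      ψ '' {x | rlo < ‖x‖ ∧ ‖x‖ < rhi} ⊆ centralSurfaceSet T →
      IsNonSeparating T (Set.range fun x : Metric.sphere (0 : EuclideanSpace ℝ (Fin 2)) 1 =>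
        ψ (r₀ • (x : EuclideanSpace ℝ (Fin 2)))) →
      IsNonSeparating T (Set.range fun x : Metric.sphere (0 : EuclideanSpace ℝ (Fin 2)) 1 =>
        ψ (r₁ • (x : EuclideanSpace ℝ (Fin 2)))) := by
  intro M _ _ _ _ _ g k T hT ψ rlo r₀ r₁ rhi h₀ h₁ hlo₀ hlo₁ hhi₀ hhi₁ hs hinj himm hψF hns
  set A : Set (EuclideanSpace ℝ (Fin 2)) := {x | rlo < ‖x‖ ∧ ‖x‖ < rhi} with hA_def
  have hnorm : ∀ {c : ℝ}, 0 < c → ∀ x : Metric.sphere (0 : EuclideanSpace ℝ (Fin 2)) 1,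
      ‖c • (x : EuclideanSpace ℝ (Fin 2))‖ = c := fun hc x => by
    rw [norm_smul, Real.norm_of_nonneg hc.le, norm_eq_of_mem_sphere x, mul_one]
  have hmem₀ : ∀ x : Metric.sphere (0 : EuclideanSpace ℝ (Fin 2)) 1,
      r₀ • (x : EuclideanSpace ℝ (Fin 2)) ∈ A := fun x => by
    simp only [hA_def, mem_setOf_eq, hnorm h₀]; exact ⟨hlo₀, hhi₀⟩
  have hmem₁ : ∀ x : Metric.sphere (0 : EuclideanSpace ℝ (Fin 2)) 1,
      r₁ • (x : EuclideanSpace ℝ (Fin 2)) ∈ A := fun x => by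
    simp only [hA_def, mem_setOf_eq, hnorm h₁]; exact ⟨hlo₁, hhi₁⟩
  -- clause (iii) for the pair `(0, 1)`: the handlebody `h(H)` with `h(∂H) = F`
  have h01 : (0 : Fin 3) ≠ 1 := by decide
  obtain ⟨H, _, _, h, hM, hHc, -, -, hh, -, hbd⟩ := hT.2.2 0 1 h01
  haveI := hM
  haveI := hHc
  have hF : centralSurfaceSet T = h '' (𝓡∂ 3).boundary H := hbd.symm
  have hFH : centralSurfaceSet T ⊆ range h := by rw [hF]; exact image_subset_range _ _
  have hψbd : ψ '' A ⊆ h '' (𝓡∂ 3).boundary H := by rw [← hF]; exact hψF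
  have hc₀F : ∀ x : Metric.sphere (0 : EuclideanSpace ℝ (Fin 2)) 1,
      ψ (r₀ • (x : EuclideanSpace ℝ (Fin 2))) ∈ centralSurfaceSet T := fun x =>
    hψF ⟨_, hmem₀ x, rfl⟩
  have hc₁F : ∀ x : Metric.sphere (0 : EuclideanSpace ℝ (Fin 2)) 1,
      ψ (r₁ • (x : EuclideanSpace ℝ (Fin 2))) ∈ centralSurfaceSet T := fun x =>
    hψF ⟨_, hmem₁ x, rfl⟩
  -- `H` is nonempty: the circle `ψ(r₀ 𝕊¹)` is a nonempty subset of `F ⊆ h(H)`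
  set x₀ : Metric.sphere (0 : EuclideanSpace ℝ (Fin 2)) 1 :=
    ⟨EuclideanSpace.single 0 1, by simp⟩ with hx₀_def
  haveI : Nonempty H := by
    obtain ⟨z, -⟩ := hFH (hc₀F x₀)
    exact ⟨z⟩
  -- the sweeping diffeomorphism of `H` and the induced self-map `θ` of `h(H)`
  obtain ⟨Φ, hΦbd, hΦψ⟩ :=
    helper_exists_diffeomorph_sweep_of_annularChart M H h hh ψ rlo r₀ r₁ rhi h₀ h₁ hlo₀ hlo₁
      hhi₀ hhi₁ hs hinj himm hψbd
  have hinj_h : Injective h := hh.isEmbedding.injective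
  have hinv : ∀ w : H, invFun h (h w) = w := leftInverse_invFun hinj_h
  set θ : M → M := fun y => h (Φ (invFun h y)) with hθ_def
  have hθc : ContinuousOn θ (range h) := by
    have hinvc : ContinuousOn (invFun h) (range h) :=
      (Literature.Geometry.Manifold.contMDiffOn_invFun_range hh).continuousOn
    exact (hh.contMDiff.continuous.comp Φ.continuous).comp_continuousOn hinvc
  have hθh : ∀ w : H, θ (h w) = h (Φ w) := fun w => by
    show h (Φ (invFun h (h w))) = h (Φ w)
    rw [hinv w]
  -- `θ` carries the `r₀`-circle to the `r₁`-circle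
  have hθψ : ∀ x : Metric.sphere (0 : EuclideanSpace ℝ (Fin 2)) 1,
      θ (ψ (r₀ • (x : EuclideanSpace ℝ (Fin 2)))) = ψ (r₁ • (x : EuclideanSpace ℝ (Fin 2))) := by
    intro x
    show h (Φ (invFun h (ψ (r₀ • (x : EuclideanSpace ℝ (Fin 2)))))) = _
    rw [hΦψ x]
    exact invFun_eq (hFH (hc₁F x))
  -- `θ` is injective on `range h`
  have hθinj : ∀ w w' : H, θ (h w) = θ (h w') → w = w' := fun w w' hww => by
    rw [hθh, hθh] at hww
    exact Φ.injective (hinj_h hww)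
  -- the image of `F ∖ ψ(r₀ 𝕊¹)` is `F ∖ ψ(r₁ 𝕊¹)`
  have himage : θ '' (centralSurfaceSet T \
      Set.range fun x : Metric.sphere (0 : EuclideanSpace ℝ (Fin 2)) 1 =>
        ψ (r₀ • (x : EuclideanSpace ℝ (Fin 2)))) =
      centralSurfaceSet T \
        Set.range fun x : Metric.sphere (0 : EuclideanSpace ℝ (Fin 2)) 1 =>
          ψ (r₁ • (x : EuclideanSpace ℝ (Fin 2))) := by
    apply Subset.antisymm
    · rintro _ ⟨y, ⟨hyF, hyc⟩, rfl⟩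
      rw [hF] at hyF
      obtain ⟨w, hw, rfl⟩ := hyF
      have hΦw : Φ w ∈ (𝓡∂ 3).boundary H := by rw [← hΦbd]; exact mem_image_of_mem Φ hw
      refine ⟨?_, ?_⟩
      · rw [hθh w, hF]; exact mem_image_of_mem h hΦw
      · rintro ⟨x, hx⟩
        apply hyc
        -- `ψ (r₀ x) = h w₀`; then `θ (h w₀) = ψ (r₁ x) = θ (h w)` forces `w₀ = w`
        obtain ⟨w₀, hw₀⟩ := hFH (hc₀F x)
        refine ⟨x, ?_⟩
        have e1 : θ (h w₀) = θ (h w) := by rw [hw₀, hθψ x]; exact hx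
        show ψ (r₀ • (x : EuclideanSpace ℝ (Fin 2))) = h w
        rw [← hw₀, hθinj w₀ w e1]
    · rintro z ⟨hzF, hzc⟩
      rw [hF] at hzF
      obtain ⟨w', hw', rfl⟩ := hzF
      have hw'Φ : w' ∈ Φ '' (𝓡∂ 3).boundary H := by rw [hΦbd]; exact hw'
      obtain ⟨w, hw, rfl⟩ := hw'Φ
      refine ⟨h w, ⟨by rw [hF]; exact mem_image_of_mem h hw, ?_⟩, hθh w⟩
      rintro ⟨x, hx⟩
      apply hzc
      refine ⟨x, ?_⟩
      have hx' : ψ (r₀ • (x : EuclideanSpace ℝ (Fin 2))) = h w := hx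
      show ψ (r₁ • (x : EuclideanSpace ℝ (Fin 2))) = h (Φ w)
      rw [← hθψ x, hx', hθh w]
  unfold IsNonSeparating at hns ⊢
  rw [← himage]
  exact hns.image θ (hθc.mono (sdiff_subset.trans hFH))

end Summit.SmoothPoincare4.SmoothPoincare4.Theorems

end
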